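import Summits.ValiantsHypothesis.ValiantsHypothesis.Theses.FifoMatching
import Literature.Computability.AlgebraicComplexity.ArithCircuitProofs
import Literature.Computability.AlgebraicComplexity.RealTauConjectureDepthFour

/-!
# `FifoMatching.NNDivisionHard` (stmt-ValiantsHypothesis-21181) — the TROPICAL SHADOW of a cheap
cofactor, in kernel: what a refutation of the crux would cost (val-idea-41 g7, W7 REFUTE lens)

Genre: `Theorems/PerMultiplesHard/Negative/ExclusionBridge.lean` («what a refutation would cost»,
crux 5068).  Formulation of record executed here: val-idea-43 g7, `Cruxes/NNDivisionHard/HARVEST-g7-oqh.md`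
§2 (the (min,+)-pair weakening `C⁻` and the chain `C⁻ ⇒ NNDivisionHard`, there on paper with a typing
plan).  This file makes chain (i) KERNEL and adds the 0/1 DECISION READING that carries the Boolean
calibration of the memo `TropicalCalibration41.md`:

* `β : ℝ≥0 →+* 𝕋`, `𝕋 = Tropical (WithTop ℕ)` (min-plus on `ℕ ∪ {+∞}`), the ZERO-PATTERN map
  (`0 ↦ 0_𝕋 = +∞`, `x > 0 ↦ 1_𝕋 = 0`).  It is a SEMIRING HOMOMORPHISM precisely because `ℝ≥0` has no
  cancellation to zero (`x + y = 0 → x = y = 0`, `xy = 0 → x = 0 ∨ y = 0`): this one fact is the whole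
  «`supp (NN·h) = supp NN + supp h`, no cancellation» step — no support calculus is needed.
* `untrop_tval` (READING): the tropical value `eval_w (map β p)` is the least `w`-weight of a support
  monomial of `p` (the support function of `Newt p` in direction `−w`, on the lattice); finite for
  `p ≠ 0` (`untrop_tval_ne_top`); multiplicative = additive (`tval_mul`, a `map_mul`).
* `untrop_tval_nnPolyS`: for the route's polynomial `NN` (verbatim term, `nnPolyS`,
  `nnDivisionHard_iff : NNDivisionHard ↔ … := Iff.rfl`) the value is `minNFPM`, the minimum `w`-weight
  of a nest-free perfect matching; `minNFPM_eq_zero_iff`: on the 0/1 weights `w_G = [e ∉ G]` it is `0`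
  iff the ordered graph `G` HAS a nest-free perfect matching (the NP-complete shadow of the route
  header: shuffle squares, BussSoltys2014 / RizziVialette2013 / GrytczukPawlikRucinski2025 Prop. 1).
* `tropicalPair_of_not_nnDivisionHard` (THE SHADOW): `¬ NNDivisionHard` gives `c` and, for
  infinitely many `n`, a cofactor `h ≠ 0` and fan-in-two circuits `P₁, P₂` over `ℝ≥0` of total size
  `≤ 2^((log₂ n + c)^c)` whose β-images (same size, same shape, constant-free over `𝕋` in the
  tree's sense `HasSignConstants` = constants in `{0_𝕋, 1_𝕋} = {+∞, 0}`, `hasSignConstants_map_β`,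
  `isSignConstant_iff`) compute `map β (NN·h)` and `map β h` over `𝕋`;
  `pair_values`: `value(P₁.map β)(w) = minNFPM(w) + value(P₂.map β)(w)` with the second value
  finite (Jukna's «division ↦ subtraction», *Tropical Circuit Complexity* (2023) Cor. 6.4 + fn. 1,
  here with constants); `nfpm_iff_values_eq`: **`G` has a nest-free perfect matching iff the two
  circuit values AGREE on `w_G`** — one equality test of two (min,+) values, not even a subtraction;
  `nfpm_iff_value_eq_one_of_constTerm` (MONOTONE TIER): if `h(0) ≠ 0` the first value alone decides it
  by a zero test, which on 0/1 weights is a monotone Boolean circuit of the same size (memo §2′).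

The two remaining textbook steps of the calibration «`¬ NNDivisionHard ⇒ SHUFFLE-SQUARE ∈
io-SIZE(2^{O((log n + c)^c)}) ⇒ NP ⊆ io-QP/poly`» (Boolean simulation of (min,+) gates on
`O(size)`-bit registers; NP-completeness of shuffle squares; right-padding) are NOT in the tree and
are carried on paper in the memo.  Honest framing: CALIBRATION; concludes no route item; 0 distance
on `C′`/COR-VIRTUAL; `NNDivisionHard` OPEN; VP ≠ VNP is NOT proved by anything here.

Theorems-side port (val-port-1 g4; critic of record val-idea-crit-9 g4, V#161a kernel δ + V#162b PORT GO terms) of val-idea-41 g7's crux workfile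
`Cruxes/NNDivisionHard/TropicalCalibration41.lean` @47b6585f5fb9 (sha16 e5b90f1af5f4ff04, 464 l.): declaration texts VERBATIM; split at the `end NN` seam into
`Theorems/NNDivisionHard/Negative/TropicalCalibration.lean` (𝕋 / `nnPolyS` / β / `tval` readings / `minNFPM`) and `…/Negative/TropicalCalibrationShadow.lean`
(`BoolConstants` + the shadow of a cheap cofactor, ★ `booleanShadow_of_not_nnDivisionHard`); namespace `Summit.ValiantsHypothesis.Theorems.NNDivisionHardNegative.TropicalCalibration`.
CALIBRATION of record (¬ `NNDivisionHard` ⇒ a Boolean/tropical shadow), helper lane; nothing closes; `NNDivisionHard` (stmt-21181) OPEN; VP ≠ VNP NOT proved.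
-/


noncomputable section

open MvPolynomial
open scoped NNReal

namespace Summit.ValiantsHypothesis.Theorems.NNDivisionHardNegative.TropicalCalibration

open Literature.Computability.AlgebraicComplexity
open Summit.ValiantsHypothesis.ValiantsHypothesis.Theses.FifoMatching (NNDivisionHard)

/-- The min-plus tropical semiring on `ℕ ∪ {+∞}` (`+` = min, `*` = +, `0 = +∞`, `1 = 0`);
a Mathlib `CommSemiring`. [cite: Jukna2023Tropical, §1.2] -/
abbrev 𝕋 : Type := Tropical (WithTop ℕ)

/-! ### The crux, restated over the named polynomial -/

/-- The route's nest-free matching polynomial `NN` on `[N]` over a commutative semiring — the route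
decl's term verbatim (sum over nest-free fixed-point-free involutions `M` of `∏_{i < M i} X (i, M i)`).
(`Theorems/FifoMatchingNNInVNPDefs.nnPoly` is the same term but is declared over a `CommRing`.) [folklore] -/
def nnPolyS (N : ℕ) (k : Type*) [CommSemiring k] : MvPolynomial (Fin N × Fin N) k :=
  ∑ M : Fin N → Fin N,
    if ((∀ i, M (M i) = i) ∧ (∀ i, M i ≠ i) ∧ ∀ i j, i < j → j < M j → M j < M i → False) then
      ∏ i : Fin N, (if i < M i then X (i, M i) else 1) else 0

/-- `NNDivisionHard` unfolded over `nnPolyS` — by `Iff.rfl`. [folklore] -/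
theorem nnDivisionHard_iff :
    NNDivisionHard ↔ ∀ c : ℕ, ∃ n₀ : ℕ, ∀ n ≥ n₀, ∀ h : MvPolynomial (Fin (2 * n) × Fin (2 * n)) ℝ≥0,
      h ≠ 0 → 2 ^ ((Nat.log 2 n + c) ^ c) < complexity (nnPolyS (2 * n) ℝ≥0 * h) + complexity h :=
  Iff.rfl

/-! ### The zero-pattern homomorphism `β : ℝ≥0 →+* 𝕋` -/

/-- The ZERO-PATTERN map `β(0) = 0_𝕋 (= +∞)`, `β(x) = 1_𝕋 (= 0)` for `x > 0`.  A semiring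
homomorphism because `ℝ≥0` has no additive and no multiplicative cancellation to `0`
(Jukna 2023 §1.12: Minkowski circuits = coefficient-free monotone circuits). [cite: Jukna2023Tropical, §1.12] -/
def β : ℝ≥0 →+* 𝕋 where
  toFun x := if x = 0 then 0 else 1
  map_zero' := by simp
  map_one' := by simp
  map_add' x y := by
    rcases eq_or_ne x 0 with rfl | hx
    · simp
    rcases eq_or_ne y 0 with rfl | hy
    · simp [hx]
    · have hxy : x + y ≠ 0 := ne_of_gt (add_pos (pos_iff_ne_zero.mpr hx) (pos_iff_ne_zero.mpr hy))
      simp only [hx, hy, hxy, if_false]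
      exact (Tropical.add_eq_left le_rfl).symm
  map_mul' x y := by
    rcases eq_or_ne x 0 with rfl | hx
    · simp
    rcases eq_or_ne y 0 with rfl | hy
    · simp [hx]
    · simp [hx, hy, mul_ne_zero hx hy]

/-- `β` unfolded: `0 ↦ 0_𝕋`, nonzero `↦ 1_𝕋`. -/
@[simp] theorem β_apply (x : ℝ≥0) : β x = if x = 0 then 0 else 1 := rfl

/-- `β x = 0_𝕋 ↔ x = 0`. [folklore] -/
theorem β_eq_zero_iff {x : ℝ≥0} : β x = 0 ↔ x = 0 := by
  rcases eq_or_ne x 0 with rfl | hx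
  · simp
  · simp [hx]

/-- `β x = 1_𝕋` for `x ≠ 0`. [folklore] -/
theorem β_of_ne_zero {x : ℝ≥0} (hx : x ≠ 0) : β x = 1 := by simp [hx]

/-- The image of `β` is `{0_𝕋, 1_𝕋}`. [folklore] -/
theorem β_mem (x : ℝ≥0) : β x = 0 ∨ β x = 1 := by
  rcases eq_or_ne x 0 with rfl | hx
  · simp
  · simp [hx]

/-! ### Tropical values = least weight of a support monomial -/

/-- Integer weights `w` as tropical inputs `trop (w e)`. [folklore] -/
def wt {σ : Type*} (w : σ → ℕ) : σ → 𝕋 := fun e => Tropical.trop ((w e : ℕ) : WithTop ℕ)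

/-- `untrop (wt w e) = w e`. -/
@[simp] theorem untrop_wt {σ : Type*} (w : σ → ℕ) (e : σ) :
    Tropical.untrop (wt w e) = ((w e : ℕ) : WithTop ℕ) := rfl

/-- The tropical (min-plus) value of the zero pattern of `p` at the weights `w`:
`eval (wt w) (map β p)`. [cite: Jukna2023Tropical, §1.11] -/
def tval {σ : Type*} (w : σ → ℕ) (p : MvPolynomial σ ℝ≥0) : 𝕋 :=
  MvPolynomial.eval (wt w) (MvPolynomial.map β p)

/-- Multiplicativity: `tval (p q) = tval p * tval q`, i.e. weights ADD — the «no cancellation under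
products over `ℝ≥0`» step as a homomorphism fact. [folklore] -/
theorem tval_mul {σ : Type*} (w : σ → ℕ) (p q : MvPolynomial σ ℝ≥0) :
    tval w (p * q) = tval w p * tval w q := by
  simp [tval, map_mul]

/-- The `w`-weight `Σ_e d(e)·w(e)` of an exponent vector `d`. [folklore] -/
def degW {σ : Type*} (w : σ → ℕ) (d : σ →₀ ℕ) : ℕ := d.sum fun e k => k * w e

/-- `map β` does not change the support (zero pattern). [folklore] -/
theorem support_map_β {σ : Type*} (p : MvPolynomial σ ℝ≥0) :
    (MvPolynomial.map β p).support = p.support := by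
  ext d
  simp only [MvPolynomial.mem_support_iff, MvPolynomial.coeff_map, ne_eq, β_eq_zero_iff]

/-- READING: the tropical value of `p` at `w` is the least `w`-weight of a support monomial of `p`
(the lattice support function of the Newton polytope in direction `−w`). [cite: Jukna2023Tropical, §1.11] -/
theorem untrop_tval {σ : Type*} (w : σ → ℕ) (p : MvPolynomial σ ℝ≥0) :
    Tropical.untrop (tval w p) = p.support.inf fun d => ((degW w d : ℕ) : WithTop ℕ) := by
  unfold tval
  rw [← MvPolynomial.eval₂_eq_eval_map, MvPolynomial.eval₂_eq, Finset.untrop_sum']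
  apply Finset.inf_congr rfl
  intro d hd
  have hc : coeff d p ≠ 0 := MvPolynomial.mem_support_iff.mp hd
  simp only [Function.comp_apply, Tropical.untrop_mul, β_of_ne_zero hc, Tropical.untrop_one, zero_add,
    untrop_prod, Tropical.untrop_pow, untrop_wt, degW, Finsupp.sum, Nat.cast_sum, Nat.cast_mul,
    nsmul_eq_mul]

/-- The tropical value of a NONZERO `p` is finite. [folklore] -/
theorem untrop_tval_ne_top {σ : Type*} (w : σ → ℕ) {p : MvPolynomial σ ℝ≥0} (hp : p ≠ 0) :
    Tropical.untrop (tval w p) ≠ ⊤ := by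
  rw [untrop_tval]
  obtain ⟨d, hd⟩ : p.support.Nonempty := MvPolynomial.support_nonempty.mpr hp
  exact ne_top_of_le_ne_top (WithTop.coe_ne_top) (Finset.inf_le hd)

/-- Equivalently `tval w p ≠ 0_𝕋` for `p ≠ 0`. [folklore] -/
theorem tval_ne_zero {σ : Type*} (w : σ → ℕ) {p : MvPolynomial σ ℝ≥0} (hp : p ≠ 0) :
    tval w p ≠ 0 := by
  intro h0
  exact untrop_tval_ne_top w hp (by rw [h0]; rfl)

/-! ### The nest-free matching reading and its 0/1 decision version -/

section NN

variable {N : ℕ}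

/-- The `w`-weight of the arc set `{(i, M i) : i < M i}` of `M`. [folklore] -/
def arcWeight (w : Fin N × Fin N → ℕ) (M : Fin N → Fin N) : ℕ :=
  ∑ i : Fin N, if i < M i then w (i, M i) else 0

/-- The minimum `w`-weight of a nest-free perfect matching of `[N]` (`⊤ = +∞` if there is none):
the (min,+) «tropical version» of `NN` (Jukna 2023 §1.3). [cite: Jukna2023Tropical, §1.3] -/
def minNFPM (N : ℕ) (w : Fin N × Fin N → ℕ) : WithTop ℕ :=
  Finset.univ.inf fun M : Fin N → Fin N =>
    if ((∀ i, M (M i) = i) ∧ (∀ i, M i ≠ i) ∧ ∀ i j, i < j → j < M j → M j < M i → False) then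
      ((arcWeight w M : ℕ) : WithTop ℕ) else ⊤

/-- READING for `NN`: the tropical value of `NN_N` at `w` is `minNFPM N w`. [cite: Jukna2023Tropical, §1.3] -/
theorem untrop_tval_nnPolyS (w : Fin N × Fin N → ℕ) :
    Tropical.untrop (tval w (nnPolyS N ℝ≥0)) = minNFPM N w := by
  unfold tval nnPolyS minNFPM
  rw [map_sum, map_sum, Finset.untrop_sum']
  apply Finset.inf_congr rfl
  intro M _
  simp only [Function.comp_apply]
  split_ifs with hM
  · rw [map_prod, map_prod, untrop_prod, arcWeight, Nat.cast_sum]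
    apply Finset.sum_congr rfl
    intro i _
    split_ifs with hi
    · simp [wt]
    · simp
  · simp

/-- The 0/1 weights of an ordered graph `G ⊆ arcs`: `0` on `G`, `1` off `G`. [folklore] -/
def indW (G : Finset (Fin N × Fin N)) : Fin N × Fin N → ℕ := fun e => if e ∈ G then 0 else 1

/-- the indicator weight is `0` on `G`. -/
@[simp] theorem indW_of_mem {G : Finset (Fin N × Fin N)} {e : Fin N × Fin N} (h : e ∈ G) :
    indW G e = 0 := by simp [indW, h]

/-- the indicator weight is `1` off `G`. -/
@[simp] theorem indW_of_not_mem {G : Finset (Fin N × Fin N)} {e : Fin N × Fin N} (h : e ∉ G) :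
    indW G e = 1 := by simp [indW, h]

/-- `arcWeight (indW G) M = 0` iff every arc of `M` lies in `G`. [folklore] -/
theorem arcWeight_indW_eq_zero_iff (G : Finset (Fin N × Fin N)) (M : Fin N → Fin N) :
    arcWeight (indW G) M = 0 ↔ ∀ i, i < M i → (i, M i) ∈ G := by
  unfold arcWeight
  rw [Finset.sum_eq_zero_iff]
  constructor
  · intro h i hi
    have h' := h i (Finset.mem_univ i)
    rw [if_pos hi] at h'
    by_contra hni
    rw [indW_of_not_mem hni] at h'
    exact one_ne_zero h'
  · intro h i _
    by_cases hi : i < M i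
    · rw [if_pos hi, indW_of_mem (h i hi)]
    · rw [if_neg hi]

/-- DECISION READING: `minNFPM N (indW G) = 0` iff the ordered graph `G` has a nest-free perfect
matching — the NP-complete Boolean shadow of the route header (shuffle squares). [cite: BussSoltys2014, Thm 1] -/
theorem minNFPM_eq_zero_iff (G : Finset (Fin N × Fin N)) :
    minNFPM N (indW G) = 0 ↔
      ∃ M : Fin N → Fin N,
        ((∀ i, M (M i) = i) ∧ (∀ i, M i ≠ i) ∧ ∀ i j, i < j → j < M j → M j < M i → False) ∧
        ∀ i, i < M i → (i, M i) ∈ G := by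
  unfold minNFPM
  have hne : (Finset.univ : Finset (Fin N → Fin N)).Nonempty := ⟨fun i => i, Finset.mem_univ _⟩
  constructor
  · intro h
    obtain ⟨M, -, hM⟩ := Finset.exists_mem_eq_inf (Finset.univ : Finset (Fin N → Fin N)) hne
      (fun M : Fin N → Fin N =>
        if ((∀ i, M (M i) = i) ∧ (∀ i, M i ≠ i) ∧ ∀ i j, i < j → j < M j → M j < M i → False) then
          ((arcWeight (indW G) M : ℕ) : WithTop ℕ) else ⊤)
    rw [hM] at h
    by_cases hc : ((∀ i, M (M i) = i) ∧ (∀ i, M i ≠ i) ∧ ∀ i j, i < j → j < M j → M j < M i → False)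
    · rw [if_pos hc] at h
      refine ⟨M, hc, (arcWeight_indW_eq_zero_iff G M).mp ?_⟩
      exact_mod_cast h
    · rw [if_neg hc] at h
      exact absurd h WithTop.top_ne_zero
  · rintro ⟨M, hc, hG⟩
    apply le_antisymm _ bot_le
    refine (Finset.inf_le (Finset.mem_univ M)).trans ?_
    rw [if_pos hc, (arcWeight_indW_eq_zero_iff G M).mpr hG]
    simp

end NN

end Summit.ValiantsHypothesis.Theorems.NNDivisionHardNegative.TropicalCalibration
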